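import Literature.Analysis.FunctionSpaces.LpJointMeasurable
import Literature.Analysis.FunctionSpaces.L2ValuedPathDeriv
import Mathlib.MeasureTheory.Function.L2Space
import Mathlib.MeasureTheory.Integral.Prod
import HarnessLib

/-!
# Regular representatives of differentiable `L²`-valued paths (slices of Bochner integrals)

Analysis/FunctionSpaces support file (measure theory; theorem-only). A `C¹` path
`U : ℝ → L²(μ; E)` is, at each `r`, only an a.e.-class; to read off *pointwise in `x`* an
honest function `u(r, x)` that is continuous / differentiable **in `r` for a.e. `x`**, with
every slice `u(r, ·)` in the right class, one integrates a jointly measurable representative of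
the derivative. This is the measure-theoretic content of "Lemma 5.4.1"-type statements
(Dafermos–Rodnianski–Shlapentokh-Rothman, arXiv:1402.7034, §5.4: the separated coefficients
`u(ω, r)` are, for a.e. `ω`, `C²` in `r` and solve the radial ODE classically), where the base
measure space is frequency space `ℝ_ω` and `E` is `L²` of the sphere.

* `integral_path_ae_eq_integral` (**slices of the Bochner integral**): for a continuous path
  `V : [a, b] → L²(μ; E)` and a jointly measurable `v` with `v(s, ·) = V(s)` a.e. for every `s`,
  the class `∫_a^b V(s) ds ∈ L²` is represented by `x ↦ ∫_a^b v(s, x) ds`;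
* `exists_continuous_rep` (**continuous version**): a `C¹` path `U` (derivative `U'` continuous)
  has a jointly measurable representative `u` on `[a, b]` with `r ↦ u(r, x)` continuous on
  `[a, b]` for a.e. `x`;
* `exists_hasDerivAt_rep` (**differentiable version**): if moreover a jointly measurable
  representative `v` of `U'` with `r ↦ v(r, x)` continuous on `[a, b]` for a.e. `x` is given,
  then `U` has a representative `u` with `∂_r u(r, x) = v(r, x)` on `(a, b)` for a.e. `x`.
  Iterating (`U ∈ C³` ⇒ a `C²`-in-`r` representative with prescribed first and second
  derivatives: `exists_rep_deriv_two`).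

Proofs: `∫_a^b V = [x ↦ ∫_a^b v(·, x)]` by testing against `h ∈ L²` (the inner product commutes
with the Bochner integral, Fubini, Cauchy–Schwarz on `[a, b]`); then `U(r) = U(a) + ∫_a^r U'`
in `L²` and the pointwise primitive `u(r, x) = u_a(x) + ∫_a^r v(s, x) ds` is continuous, resp.
differentiable where `v(·, x)` is continuous.

## Mathlib / tree search

Tree: `exists_measurable_uncurry_of_continuousOn_Lp` (jointly measurable version of a continuous
`L^p` path, exact slices), `enorm_sq_intervalIntegral_le`,
`intervalIntegrable_of_lintegral_sq_ne_top` (`L2ValuedPathDeriv`). Mathlib: `integral_inner`, `L2.inner_def`, `integral_integral_swap`,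
`integrable_prod_iff`, `intervalIntegral.integral_eq_sub_of_hasDerivAt`,
`intervalIntegral.integral_hasDerivAt_right`, `continuousOn_primitive_interval`; nothing on
regular-in-parameter representatives of `L^p` paths.

## References

* M. Dafermos, I. Rodnianski, Y. Shlapentokh-Rothman, arXiv:1402.7034, §5.2.3 ("interpreted in
  `L²_ω l²_{mℓ}`"), Lemma 5.4.1. [DafermosRodnianskiShlapentokhrothman2014]
-/

noncomputable section

open MeasureTheory Set Filter Topology intervalIntegral Function
open scoped ENNReal NNReal Interval InnerProductSpace

namespace Literature.Analysis.FunctionSpaces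

variable {X : Type*} [MeasurableSpace X] {μ : Measure X} [SFinite μ]
  {E : Type*} [NormedAddCommGroup E] [InnerProductSpace ℂ E] [CompleteSpace E]
  [SecondCountableTopology E] [MeasurableSpace E] [BorelSpace E]

/-! ### `L²` bookkeeping -/

omit [SFinite μ] [InnerProductSpace ℂ E] [CompleteSpace E] [SecondCountableTopology E]
  [MeasurableSpace E] [BorelSpace E] in
/-- `∫ ‖u‖² = ‖u‖²` for `u ∈ L²(μ; E)`. [folklore] -/
theorem integral_norm_sq_Lp (u : Lp E 2 μ) : ∫ x, ‖u x‖ ^ 2 ∂μ = ‖u‖ ^ 2 := by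
  have hi : Integrable (fun x ↦ ‖u x‖ ^ 2) μ :=
    (memLp_two_iff_integrable_sq_norm (Lp.memLp u).1).1 (Lp.memLp u)
  rw [integral_eq_lintegral_of_nonneg_ae (ae_of_all _ fun x ↦ sq_nonneg _) hi.aestronglyMeasurable]
  have h1 : ∫⁻ x, ENNReal.ofReal (‖u x‖ ^ 2) ∂μ = ∫⁻ x, ‖u x‖ₑ ^ 2 ∂μ :=
    lintegral_congr fun x ↦ by rw [ENNReal.ofReal_pow (norm_nonneg _), ofReal_norm]
  rw [h1, lintegral_enorm_sq_eq_eLpNorm_sq, ENNReal.toReal_pow, Lp.norm_def]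

omit [SFinite μ] [InnerProductSpace ℂ E] [CompleteSpace E] [SecondCountableTopology E]
  [MeasurableSpace E] [BorelSpace E] in
/-- `∫⁻ ‖u‖ₑ² = ‖u‖²` for `u ∈ L²(μ; E)`. [folklore] -/
theorem lintegral_enorm_sq_Lp (u : Lp E 2 μ) :
    ∫⁻ x, ‖u x‖ₑ ^ 2 ∂μ = ENNReal.ofReal (‖u‖ ^ 2) := by
  rw [lintegral_enorm_sq_eq_eLpNorm_sq, Lp.norm_def, ← ENNReal.toReal_pow,
    ENNReal.ofReal_toReal (ENNReal.pow_ne_top (Lp.eLpNorm_ne_top u))]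

omit [SFinite μ] [InnerProductSpace ℂ E] [CompleteSpace E] [SecondCountableTopology E]
  [MeasurableSpace E] [BorelSpace E] in
/-- An a.e. strongly measurable function with `∫⁻ ‖w‖ₑ² < ∞` is in `L²`. [folklore] -/
theorem memLp_two_of_lintegral_sq_lt_top {E' : Type*} [NormedAddCommGroup E'] {w : X → E'}
    (hm : AEStronglyMeasurable w μ) (h : ∫⁻ x, ‖w x‖ₑ ^ 2 ∂μ < ∞) : MemLp w 2 μ := by
  refine ⟨hm, ?_⟩
  rw [lintegral_enorm_sq_eq_eLpNorm_sq] at h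
  refine lt_top_iff_ne_top.2 fun htop ↦ ?_
  rw [htop, ENNReal.top_pow two_ne_zero] at h
  exact lt_irrefl _ h

/-! ### Slices of the Bochner integral of an `L²`-valued path -/

/-- **Slices of the Bochner integral.** For a continuous path `V : [a, b] → L²(μ; E)` and a jointly
measurable `v` representing it slice-wise, `∫_a^b V(s) ds ∈ L²` is represented by
`x ↦ ∫_a^b v(s, x) ds`. [folklore] -/
theorem integral_path_ae_eq_integral {V : ℝ → Lp E 2 μ} {a b : ℝ} (hab : a ≤ b)
    (hV : ContinuousOn V (Icc a b)) {v : ℝ → X → E} (hvm : Measurable (uncurry v))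
    (hv : ∀ s ∈ Icc a b, v s =ᵐ[μ] V s) :
    ((∫ s in a..b, V s : Lp E 2 μ) : X → E) =ᵐ[μ] fun x ↦ ∫ s in a..b, v s x := by
  have hvsm : StronglyMeasurable (uncurry v) := hvm.stronglyMeasurable
  obtain ⟨M, hM⟩ : ∃ M, ∀ s ∈ Icc a b, ‖V s‖ ≤ M := isCompact_Icc.exists_bound_of_continuousOn hV
  have hM0 : 0 ≤ M := (norm_nonneg _).trans (hM a (left_mem_Icc.2 hab))
  -- slice bounds
  have hslice : ∀ s ∈ Icc a b, ∫⁻ x, ‖v s x‖ₑ ^ 2 ∂μ ≤ ENNReal.ofReal (M ^ 2) := fun s hs ↦ by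
    have hae : (fun x ↦ ‖v s x‖ₑ ^ 2) =ᵐ[μ] fun x ↦ ‖(V s) x‖ₑ ^ 2 := by
      filter_upwards [hv s hs] with x hx
      rw [hx]
    rw [lintegral_congr_ae hae, lintegral_enorm_sq_Lp]
    exact ENNReal.ofReal_le_ofReal (pow_le_pow_left₀ (norm_nonneg _) (hM s hs) 2)
  -- Tonelli: for a.e. `x`, `v(·, x)` is square integrable on `(a, b]`
  have hF : Measurable fun p : ℝ × X ↦ ‖v p.1 p.2‖ₑ ^ 2 := hvsm.enorm.pow_const 2
  have hT : ∫⁻ x, (∫⁻ s in Ioc a b, ‖v s x‖ₑ ^ 2) ∂μ ≤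
      ENNReal.ofReal (b - a) * ENNReal.ofReal (M ^ 2) := by
    rw [lintegral_lintegral_swap (f := fun x s ↦ ‖v s x‖ₑ ^ 2)
      ((hF.comp measurable_swap).aemeasurable)]
    calc ∫⁻ s in Ioc a b, ∫⁻ x, ‖v s x‖ₑ ^ 2 ∂μ ≤ ∫⁻ _ in Ioc a b, ENNReal.ofReal (M ^ 2) :=
          setLIntegral_mono measurable_const fun s hs ↦ hslice s ⟨hs.1.le, hs.2⟩
      _ = _ := by rw [setLIntegral_const, Real.volume_Ioc, mul_comm]
  have hmeasx : Measurable fun x ↦ ∫⁻ s in Ioc a b, ‖v s x‖ₑ ^ 2 :=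
    (hF.comp measurable_swap).lintegral_prod_right'
  have hfin : ∫⁻ x, (∫⁻ s in Ioc a b, ‖v s x‖ₑ ^ 2) ∂μ ≠ ∞ :=
    ne_top_of_le_ne_top (ENNReal.mul_ne_top ENNReal.ofReal_ne_top ENNReal.ofReal_ne_top) hT
  have hae : ∀ᵐ x ∂μ, ∫⁻ s in Ioc a b, ‖v s x‖ₑ ^ 2 < ∞ := ae_lt_top hmeasx hfin
  have hint_ae : ∀ᵐ x ∂μ, IntervalIntegrable (fun s ↦ v s x) volume a b := by
    filter_upwards [hae] with x hx
    exact intervalIntegrable_of_lintegral_sq_ne_top hab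
      (hvsm.comp_measurable (measurable_id.prodMk measurable_const)) hx.ne
  -- the candidate representative `w`
  set w : X → E := fun x ↦ ∫ s in a..b, v s x with hw
  have hw_eq : w = fun x ↦ ∫ s in Ioc a b, v s x := funext fun x ↦ integral_of_le hab
  have hw_sm : StronglyMeasurable w := by
    rw [hw_eq]
    exact StronglyMeasurable.integral_prod_left' (μ := volume.restrict (Ioc a b)) hvsm
  have hw_bd : ∀ x, ‖w x‖ₑ ^ 2 ≤ ENNReal.ofReal (b - a) * ∫⁻ s in Ioc a b, ‖v s x‖ₑ ^ 2 := by
    intro x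
    by_cases hx : IntervalIntegrable (fun s ↦ v s x) volume a b
    · exact enorm_sq_intervalIntegral_le hab hx
    · simp only [hw, integral_undef hx, enorm_zero, ne_eq, OfNat.ofNat_ne_zero, not_false_eq_true,
        zero_pow, zero_le]
  have hw_mem : MemLp w 2 μ := by
    refine memLp_two_of_lintegral_sq_lt_top hw_sm.aestronglyMeasurable ?_
    calc ∫⁻ x, ‖w x‖ₑ ^ 2 ∂μ
        ≤ ∫⁻ x, ENNReal.ofReal (b - a) * (∫⁻ s in Ioc a b, ‖v s x‖ₑ ^ 2) ∂μ := lintegral_mono hw_bd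
      _ = ENNReal.ofReal (b - a) * ∫⁻ x, (∫⁻ s in Ioc a b, ‖v s x‖ₑ ^ 2) ∂μ :=
          lintegral_const_mul _ hmeasx
      _ < ∞ := ENNReal.mul_lt_top ENNReal.ofReal_lt_top (lt_top_iff_ne_top.2 hfin)
  -- integrability of the path
  have hVint : IntegrableOn V (Ioc a b) :=
    (hV.integrableOn_compact isCompact_Icc).mono_set Ioc_subset_Icc_self
  -- test against `h ∈ L²`
  have key : ∀ h : Lp E 2 μ, ⟪h, ∫ s in a..b, V s⟫_ℂ = ⟪h, hw_mem.toLp w⟫_ℂ := by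
    intro h
    rw [integral_of_le hab, ← integral_inner hVint]
    -- `⟪h, V s⟫ = ∫ ⟪h x, v s x⟫`
    have h1 : ∫ s in Ioc a b, ⟪h, V s⟫_ℂ = ∫ s in Ioc a b, ∫ x, ⟪h x, v s x⟫_ℂ ∂μ := by
      refine setIntegral_congr_fun measurableSet_Ioc fun s hs ↦ ?_
      rw [L2.inner_def]
      refine integral_congr_ae ?_
      filter_upwards [hv s ⟨hs.1.le, hs.2⟩] with x hx
      rw [hx]
    -- Fubini
    have hGm : AEStronglyMeasurable (uncurry fun s x ↦ ⟪h x, v s x⟫_ℂ)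
        ((volume.restrict (Ioc a b)).prod μ) :=
      (Lp.aestronglyMeasurable h).comp_snd.inner hvsm.aestronglyMeasurable
    have hGint : Integrable (uncurry fun s x ↦ ⟪h x, v s x⟫_ℂ)
        ((volume.restrict (Ioc a b)).prod μ) := by
      rw [integrable_prod_iff hGm]
      constructor
      · rw [ae_restrict_iff' measurableSet_Ioc]
        refine ae_of_all _ fun s hs ↦ ?_
        have hi := L2.integrable_inner (𝕜 := ℂ) h (V s)
        refine hi.congr ?_
        filter_upwards [hv s ⟨hs.1.le, hs.2⟩] with x hx
        simp only [uncurry_apply_pair, hx]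
      · -- `∫ ‖⟪h x, v s x⟫‖ ≤ (‖h‖² + M²) / 2`
        have hhi : Integrable (fun x ↦ ‖h x‖ ^ 2) μ :=
          (memLp_two_iff_integrable_sq_norm (Lp.memLp h).1).1 (Lp.memLp h)
        refine Integrable.of_bound (hGm.norm.integral_prod_right') ((‖h‖ ^ 2 + M ^ 2) / 2) ?_
        · rw [ae_restrict_iff' measurableSet_Ioc]
          refine ae_of_all _ fun s hs ↦ ?_
          have hs' : s ∈ Icc a b := ⟨hs.1.le, hs.2⟩
          have hvi : Integrable (fun x ↦ ‖v s x‖ ^ 2) μ := by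
            have := (memLp_two_iff_integrable_sq_norm (Lp.memLp (V s)).1).1 (Lp.memLp (V s))
            refine this.congr ?_
            filter_upwards [hv s hs'] with x hx
            rw [hx]
          rw [Real.norm_eq_abs, abs_of_nonneg (integral_nonneg fun x ↦ norm_nonneg _)]
          calc ∫ x, ‖(uncurry fun s x ↦ ⟪h x, v s x⟫_ℂ) (s, x)‖ ∂μ
              ≤ ∫ x, (‖h x‖ ^ 2 + ‖v s x‖ ^ 2) / 2 ∂μ := by
                refine integral_mono_of_nonneg (ae_of_all _ fun x ↦ norm_nonneg _)
                  ((hhi.add hvi).div_const 2) (ae_of_all _ fun x ↦ ?_)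
                simp only [uncurry_apply_pair]
                have := norm_inner_le_norm (𝕜 := ℂ) (h x) (v s x)
                nlinarith [sq_nonneg (‖h x‖ - ‖v s x‖), norm_nonneg (h x), norm_nonneg (v s x)]
            _ = (‖h‖ ^ 2 + ∫ x, ‖v s x‖ ^ 2 ∂μ) / 2 := by
                rw [MeasureTheory.integral_div, integral_add hhi hvi, integral_norm_sq_Lp]
            _ ≤ (‖h‖ ^ 2 + M ^ 2) / 2 := by
                have h3 : ∫ x, ‖v s x‖ ^ 2 ∂μ = ‖V s‖ ^ 2 := by
                  rw [← integral_norm_sq_Lp (V s)]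
                  refine integral_congr_ae ?_
                  filter_upwards [hv s hs'] with x hx
                  rw [hx]
                rw [h3]
                have h4 : ‖V s‖ ^ 2 ≤ M ^ 2 := pow_le_pow_left₀ (norm_nonneg _) (hM s hs') 2
                linarith
    rw [h1, integral_integral_swap hGint]
    -- pointwise `∫ ⟪h x, v s x⟫ ds = ⟪h x, w x⟫`
    rw [L2.inner_def]
    refine integral_congr_ae ?_
    filter_upwards [hint_ae, hw_mem.coeFn_toLp] with x hx hwx
    rw [hwx]
    change ∫ s in Ioc a b, ⟪h x, v s x⟫_ℂ = ⟪h x, ∫ s in a..b, v s x⟫_ℂ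
    rw [integral_of_le hab]
    exact integral_inner ((intervalIntegrable_iff_integrableOn_Ioc_of_le hab).1 hx) (h x)
  have heq : (∫ s in a..b, V s) = hw_mem.toLp w := ext_inner_left ℂ key
  rw [heq]
  exact hw_mem.coeFn_toLp

/-! ### Representatives of `C¹` paths, regular in the parameter -/

omit [SFinite μ] [InnerProductSpace ℂ E] in
/-- A jointly measurable slice-wise representative of a continuous `L²` path on `[a, b]`
(the tree's `exists_measurable_uncurry_of_continuousOn_Lp`, reparametrised). [folklore] -/
theorem exists_measurable_rep_Icc {V : ℝ → Lp E 2 μ} {a b : ℝ} (hV : ContinuousOn V (Icc a b)) :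
    ∃ v : ℝ → X → E, Measurable (uncurry v) ∧ ∀ s ∈ Icc a b, v s =ᵐ[μ] V s := by
  obtain ⟨g, hgm, hg⟩ := exists_measurable_uncurry_of_continuousOn_Lp (p := 2) (T := b - a)
    (fun t ↦ V (a + t)) (hV.comp (continuousOn_const.add continuousOn_id)
      fun t ht ↦ ⟨by linarith [ht.1], by linarith [ht.2]⟩)
  refine ⟨fun s ↦ g (s - a), hgm.comp ((measurable_fst.sub_const a).prodMk measurable_snd),
    fun s hs ↦ ?_⟩
  have := hg (s - a) ⟨by linarith [hs.1], by linarith [hs.2]⟩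
  simpa using this

omit [InnerProductSpace ℂ E] [CompleteSpace E] in
/-- Under the hypotheses of `integral_path_ae_eq_integral`, `v(·, x)` is interval integrable
on `[a, b]` for a.e. `x`. [folklore] -/
theorem ae_intervalIntegrable_rep {V : ℝ → Lp E 2 μ} {a b : ℝ} (hab : a ≤ b)
    (hV : ContinuousOn V (Icc a b)) {v : ℝ → X → E} (hvm : Measurable (uncurry v))
    (hv : ∀ s ∈ Icc a b, v s =ᵐ[μ] V s) :
    ∀ᵐ x ∂μ, IntervalIntegrable (fun s ↦ v s x) volume a b := by
  have hvsm : StronglyMeasurable (uncurry v) := hvm.stronglyMeasurable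
  obtain ⟨M, hM⟩ : ∃ M, ∀ s ∈ Icc a b, ‖V s‖ ≤ M := isCompact_Icc.exists_bound_of_continuousOn hV
  have hslice : ∀ s ∈ Icc a b, ∫⁻ x, ‖v s x‖ₑ ^ 2 ∂μ ≤ ENNReal.ofReal (M ^ 2) := fun s hs ↦ by
    have hae : (fun x ↦ ‖v s x‖ₑ ^ 2) =ᵐ[μ] fun x ↦ ‖(V s) x‖ₑ ^ 2 := by
      filter_upwards [hv s hs] with x hx
      rw [hx]
    rw [lintegral_congr_ae hae, lintegral_enorm_sq_Lp]
    exact ENNReal.ofReal_le_ofReal (pow_le_pow_left₀ (norm_nonneg _) (hM s hs) 2)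
  have hF : Measurable fun p : ℝ × X ↦ ‖v p.1 p.2‖ₑ ^ 2 := hvsm.enorm.pow_const 2
  have hT : ∫⁻ x, (∫⁻ s in Ioc a b, ‖v s x‖ₑ ^ 2) ∂μ ≤
      ENNReal.ofReal (b - a) * ENNReal.ofReal (M ^ 2) := by
    rw [lintegral_lintegral_swap (f := fun x s ↦ ‖v s x‖ₑ ^ 2)
      ((hF.comp measurable_swap).aemeasurable)]
    calc ∫⁻ s in Ioc a b, ∫⁻ x, ‖v s x‖ₑ ^ 2 ∂μ ≤ ∫⁻ _ in Ioc a b, ENNReal.ofReal (M ^ 2) :=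
          setLIntegral_mono measurable_const fun s hs ↦ hslice s ⟨hs.1.le, hs.2⟩
      _ = _ := by rw [setLIntegral_const, Real.volume_Ioc, mul_comm]
  have hmeasx : Measurable fun x ↦ ∫⁻ s in Ioc a b, ‖v s x‖ₑ ^ 2 :=
    (hF.comp measurable_swap).lintegral_prod_right'
  have hfin : ∫⁻ x, (∫⁻ s in Ioc a b, ‖v s x‖ₑ ^ 2) ∂μ ≠ ∞ :=
    ne_top_of_le_ne_top (ENNReal.mul_ne_top ENNReal.ofReal_ne_top ENNReal.ofReal_ne_top) hT
  filter_upwards [ae_lt_top hmeasx hfin] with x hx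
  exact intervalIntegrable_of_lintegral_sq_ne_top hab
    (hvsm.comp_measurable (measurable_id.prodMk measurable_const)) hx.ne

omit [SFinite μ] [CompleteSpace E] in
/-- Joint measurability of the parametric primitive `(r, x) ↦ ∫_a^r v(s, x) ds`. [folklore] -/
theorem measurable_uncurry_primitive {v : ℝ → X → E} (hvm : Measurable (uncurry v)) (a : ℝ) :
    Measurable (uncurry fun r x ↦ ∫ s in a..r, v s x) := by
  -- `∫_a^r = ∫_{(a, r]} - ∫_{(r, a]}`, each a parametric integral of a measurable integrand
  have hv3 : Measurable fun p : (ℝ × X) × ℝ ↦ v p.2 p.1.2 :=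
    hvm.comp (measurable_snd.prodMk (measurable_snd.comp measurable_fst))
  have h1 : Measurable fun p : (ℝ × X) × ℝ ↦ (Ioc a p.1.1).indicator (fun s ↦ v s p.1.2) p.2 := by
    have hset : MeasurableSet {p : (ℝ × X) × ℝ | a < p.2 ∧ p.2 ≤ p.1.1} :=
      (measurableSet_lt measurable_const measurable_snd).inter
        (measurableSet_le measurable_snd (measurable_fst.comp measurable_fst))
    have : (fun p : (ℝ × X) × ℝ ↦ (Ioc a p.1.1).indicator (fun s ↦ v s p.1.2) p.2) =
        {p : (ℝ × X) × ℝ | a < p.2 ∧ p.2 ≤ p.1.1}.indicator fun p ↦ v p.2 p.1.2 := by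
      funext p
      simp only [indicator, mem_Ioc, mem_setOf_eq]
    rw [this]
    exact hv3.indicator hset
  have h2 : Measurable fun p : (ℝ × X) × ℝ ↦ (Ioc p.1.1 a).indicator (fun s ↦ v s p.1.2) p.2 := by
    have hset : MeasurableSet {p : (ℝ × X) × ℝ | p.1.1 < p.2 ∧ p.2 ≤ a} :=
      (measurableSet_lt (measurable_fst.comp measurable_fst) measurable_snd).inter
        (measurableSet_le measurable_snd measurable_const)
    have : (fun p : (ℝ × X) × ℝ ↦ (Ioc p.1.1 a).indicator (fun s ↦ v s p.1.2) p.2) =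
        {p : (ℝ × X) × ℝ | p.1.1 < p.2 ∧ p.2 ≤ a}.indicator fun p ↦ v p.2 p.1.2 := by
      funext p
      simp only [indicator, mem_Ioc, mem_setOf_eq]
    rw [this]
    exact hv3.indicator hset
  have e1 : (uncurry fun r x ↦ ∫ s in a..r, v s x) = fun p : ℝ × X ↦
      (∫ s, (Ioc a p.1).indicator (fun s ↦ v s p.2) s) -
        ∫ s, (Ioc p.1 a).indicator (fun s ↦ v s p.2) s := by
    funext p
    simp only [uncurry, intervalIntegral, MeasureTheory.integral_indicator measurableSet_Ioc]
  rw [e1]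
  exact (h1.stronglyMeasurable.integral_prod_right' (ν := volume)).measurable.sub
    (h2.stronglyMeasurable.integral_prod_right' (ν := volume)).measurable

/-- **Representative of a `C¹` path by integrating a representative of the derivative.** Let
`U : ℝ → L²(μ; E)` have derivative `U₁(r)` at every `r`, `U₁` continuous, and let `v` be a
jointly measurable slice-wise representative of `U₁` on `[a, b]`. Then
`u(r, x) = u_a(x) + ∫_a^r v(s, x) ds` (with `u_a` a representative of `U(a)`) represents `U(r)`
for every `r ∈ [a, b]`. [folklore] -/
theorem primitive_rep_ae_eq {U U₁ : ℝ → Lp E 2 μ} {a b : ℝ}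
    (hU : ∀ r, HasDerivAt U (U₁ r) r) (hU₁ : Continuous U₁)
    {v : ℝ → X → E} (hvm : Measurable (uncurry v)) (hv : ∀ s ∈ Icc a b, v s =ᵐ[μ] U₁ s)
    {r : ℝ} (hr : r ∈ Icc a b) :
    (fun x ↦ (Lp.aestronglyMeasurable (U a)).mk (U a) x + ∫ s in a..r, v s x) =ᵐ[μ] U r := by
  have hFTC : U r = U a + ∫ s in a..r, U₁ s := by
    rw [integral_eq_sub_of_hasDerivAt (fun s _ ↦ hU s) (hU₁.intervalIntegrable _ _)]
    abel
  have hS := integral_path_ae_eq_integral (μ := μ) hr.1 hU₁.continuousOn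
    hvm (fun s hs ↦ hv s ⟨hs.1, hs.2.trans hr.2⟩)
  rw [hFTC]
  filter_upwards [Lp.coeFn_add (U a) (∫ s in a..r, U₁ s), hS,
    (Lp.aestronglyMeasurable (U a)).ae_eq_mk] with x h1 h2 h3
  rw [h1, Pi.add_apply, h2, h3]

/-- **Continuous-in-`r` representative of a `C¹` path** on `[a, b]`. [folklore] -/
theorem exists_continuousOn_rep {U U₁ : ℝ → Lp E 2 μ} {a b : ℝ} (hab : a ≤ b)
    (hU : ∀ r, HasDerivAt U (U₁ r) r) (hU₁ : Continuous U₁) :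
    ∃ u : ℝ → X → E, Measurable (uncurry u) ∧ (∀ r ∈ Icc a b, u r =ᵐ[μ] U r) ∧
      ∀ᵐ x ∂μ, ContinuousOn (fun r ↦ u r x) (Icc a b) := by
  obtain ⟨v, hvm, hv⟩ := exists_measurable_rep_Icc (μ := μ) (hU₁.continuousOn (s := Icc a b))
  set u₀ : X → E := (Lp.aestronglyMeasurable (U a)).mk (U a)
  refine ⟨fun r x ↦ u₀ x + ∫ s in a..r, v s x, ?_, fun r hr ↦ primitive_rep_ae_eq hU hU₁ hvm hv hr,
    ?_⟩
  · exact ((Lp.aestronglyMeasurable (U a)).stronglyMeasurable_mk.measurable.comp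
      measurable_snd).add (measurable_uncurry_primitive hvm a)
  · filter_upwards [ae_intervalIntegrable_rep hab hU₁.continuousOn hvm hv] with x hx
    have hI : IntegrableOn (fun s ↦ v s x) (uIcc a b) := by
      rw [uIcc_of_le hab, integrableOn_Icc_iff_integrableOn_Ioc]
      exact (intervalIntegrable_iff_integrableOn_Ioc_of_le hab).1 hx
    have hc := continuousOn_primitive_interval (μ := volume) hI
    rw [uIcc_of_le hab] at hc
    exact continuousOn_const.add hc

/-- **Differentiable-in-`r` representative with prescribed derivative.** If the representative
`v` of the continuous path `U₁` is continuous in `r` on `[a, b]` for a.e. `x`, then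
`r ↦ u₀(x) + ∫_a^r v(s, x) ds` has derivative `v(r, x)` at every `r ∈ (a, b)`, for a.e. `x`.
[folklore] -/
theorem ae_hasDerivAt_primitive_rep {U₁ : ℝ → Lp E 2 μ} {a b : ℝ} (hab : a ≤ b)
    (hU₁ : Continuous U₁) {v : ℝ → X → E} (hvm : Measurable (uncurry v))
    (hv : ∀ s ∈ Icc a b, v s =ᵐ[μ] U₁ s)
    (hvc : ∀ᵐ x ∂μ, ContinuousOn (fun r ↦ v r x) (Icc a b)) (u₀ : X → E) :
    ∀ᵐ x ∂μ, ∀ r ∈ Ioo a b,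
      HasDerivAt (fun r ↦ u₀ x + ∫ s in a..r, v s x) (v r x) r := by
  filter_upwards [ae_intervalIntegrable_rep hab hU₁.continuousOn hvm hv, hvc] with x hx hxc r hr
  have hmeas : StronglyMeasurable fun s ↦ v s x :=
    (hvm.comp (measurable_id.prodMk measurable_const)).stronglyMeasurable
  have hint : IntervalIntegrable (fun s ↦ v s x) volume a r :=
    hx.mono_set (by
      rw [uIcc_of_le hab, uIcc_of_le hr.1.le]
      exact Icc_subset_Icc le_rfl hr.2.le)
  have hd := integral_hasDerivAt_right hint hmeas.stronglyMeasurableAtFilter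
    (hxc.continuousAt (Icc_mem_nhds hr.1 hr.2))
  exact hd.const_add _

/-- **`C²`-in-`r` representatives** (the case used for separated wave equations): let
`U ∈ C³` as an `L²(μ; E)`-valued map (`U₁, U₂, U₃` its successive derivatives, `U₃`
continuous). Then on `[a, b]` there are jointly measurable `u, u₁, u₂` representing
`U, U₁, U₂` slice-wise, with `∂_r u = u₁`, `∂_r u₁ = u₂` on `(a, b)` and `u₂(·, x)` continuous on
`[a, b]`, for a.e. `x`. [folklore] -/
theorem exists_rep_deriv_two {U U₁ U₂ U₃ : ℝ → Lp E 2 μ} {a b : ℝ} (hab : a ≤ b)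
    (hU : ∀ r, HasDerivAt U (U₁ r) r) (hU₁ : ∀ r, HasDerivAt U₁ (U₂ r) r)
    (hU₂ : ∀ r, HasDerivAt U₂ (U₃ r) r) (hU₃ : Continuous U₃) :
    ∃ u u₁ u₂ : ℝ → X → E, Measurable (uncurry u) ∧ Measurable (uncurry u₁) ∧
      Measurable (uncurry u₂) ∧ (∀ r ∈ Icc a b, u r =ᵐ[μ] U r) ∧
      (∀ r ∈ Icc a b, u₁ r =ᵐ[μ] U₁ r) ∧ (∀ r ∈ Icc a b, u₂ r =ᵐ[μ] U₂ r) ∧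
      ∀ᵐ x ∂μ, ContinuousOn (fun r ↦ u₂ r x) (Icc a b) ∧
        (∀ r ∈ Ioo a b, HasDerivAt (fun r ↦ u₁ r x) (u₂ r x) r) ∧
        (∀ r ∈ Ioo a b, HasDerivAt (fun r ↦ u r x) (u₁ r x) r) := by
  have hcU₂ : Continuous U₂ := continuous_iff_continuousAt.2 fun r ↦ (hU₂ r).continuousAt
  have hcU₁ : Continuous U₁ := continuous_iff_continuousAt.2 fun r ↦ (hU₁ r).continuousAt
  -- `u₂`: continuous-in-`r` representative of `U₂`
  obtain ⟨u₂, hm₂, hr₂, hc₂⟩ := exists_continuousOn_rep (μ := μ) hab hU₂ hU₃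
  -- `u₁`: primitive of `u₂`
  set w₁ : X → E := (Lp.aestronglyMeasurable (U₁ a)).mk (U₁ a)
  set u₁ : ℝ → X → E := fun r x ↦ w₁ x + ∫ s in a..r, u₂ s x
  have hm₁ : Measurable (uncurry u₁) :=
    ((Lp.aestronglyMeasurable (U₁ a)).stronglyMeasurable_mk.measurable.comp measurable_snd).add
      (measurable_uncurry_primitive hm₂ a)
  have hr₁ : ∀ r ∈ Icc a b, u₁ r =ᵐ[μ] U₁ r := fun r hr ↦ primitive_rep_ae_eq hU₁ hcU₂ hm₂ hr₂ hr
  have hd₁ := ae_hasDerivAt_primitive_rep (μ := μ) hab hcU₂ hm₂ hr₂ hc₂ w₁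
  -- `u`: primitive of `u₁`
  set w₀ : X → E := (Lp.aestronglyMeasurable (U a)).mk (U a)
  set u : ℝ → X → E := fun r x ↦ w₀ x + ∫ s in a..r, u₁ s x
  have hm₀ : Measurable (uncurry u) :=
    ((Lp.aestronglyMeasurable (U a)).stronglyMeasurable_mk.measurable.comp measurable_snd).add
      (measurable_uncurry_primitive hm₁ a)
  have hr₀ : ∀ r ∈ Icc a b, u r =ᵐ[μ] U r := fun r hr ↦ primitive_rep_ae_eq hU hcU₁ hm₁ hr₁ hr
  -- continuity of `u₁(·, x)` on `[a, b]` for a.e. `x`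
  have hc₁ : ∀ᵐ x ∂μ, ContinuousOn (fun r ↦ u₁ r x) (Icc a b) := by
    filter_upwards [ae_intervalIntegrable_rep hab hcU₂.continuousOn hm₂ hr₂] with x hx
    have hI : IntegrableOn (fun s ↦ u₂ s x) (uIcc a b) := by
      rw [uIcc_of_le hab, integrableOn_Icc_iff_integrableOn_Ioc]
      exact (intervalIntegrable_iff_integrableOn_Ioc_of_le hab).1 hx
    have hc := continuousOn_primitive_interval (μ := volume) hI
    rw [uIcc_of_le hab] at hc
    exact continuousOn_const.add hc
  have hd₀ := ae_hasDerivAt_primitive_rep (μ := μ) hab hcU₁ hm₁ hr₁ hc₁ w₀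
  refine ⟨u, u₁, u₂, hm₀, hm₁, hm₂, hr₀, hr₁, hr₂, ?_⟩
  filter_upwards [hc₂, hd₁, hd₀] with x h2 h1 h0
  exact ⟨h2, h1, h0⟩


end Literature.Analysis.FunctionSpaces
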